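import Summits.CriticalPhenomena.Ising3D.Control2DIsland
import Mathlib.Topology.Algebra.InfiniteSum.Real
import Mathlib.Tactic.Linarith
import Mathlib.Tactic.Positivity
import HarnessLib

/-!
# The 2D Ising blind control: two-sided OPE data (kind `ope2`) — what a T-isolated lower bound on `p_T` asserts
(cell `pub-ising3x`, seat controls-1 gen 12; `SCOPE.md` §4 `### controls-1 v14`, round RB-6)

HONEST FRAMING: lottery ticket; floor = tightest certified 3D Ising CFT bounds; no exact-solution
claim without a proof. CONTROL-ONLY: the two-dimensional axiom set `A2D′` (de la Fuente,
arXiv:1904.09801 §2: `ε` the only `ℤ₂`-even scalar quasi-primary below a gap `G`, the stress tensor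
plus a spin-2 gap `δ`, unitarity) is NOT the three-dimensional floor's axiom set.

`Control2DBootstrap.lean` types the one-sided OPE item `OpeBound s gap P` (`p_T < P`, hence
`c > Δ_σ²/(2P)` by the Ward identity) and proves its soundness for evaluation-continuous functionals.
RB-6 (controls-1 gen 12) adds the certificate kind `ope2` (format `deriv-functional-2d/4`, readers
`verify_A2d.py 2.4` / `verify_B2d.py 2.3`): with the stress tensor ISOLATED (`δ > 0`) a LOWER bound
`p_T > P` is also an exclusion statement — obligations `φ[F_𝟙] + P·φ[F_T] > 0`, `φ[F_T] < 0`, and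
`φ ≥ 0` on every other block allowed by `A2D′` with the `ε` box `[e₁, e₂]` as scalar input — and the
pair (lower, upper) is a two-sided interval for `p_T`, i.e. for `c = Δ_σ²/(2 p_T)`.

This file TYPES both statements (`OpeUpperA2D`, `OpeLowerA2D`, about the TOTAL coefficient
`stressCoeff` of the `(2,2)` block — for the lower bound a per-quasi-primary statement would be false,
the sum rule only sees the total) and PROVES:
* `indicator_tsum_bound_of_hasSum` — the abstract termwise step: if `∑ p_i a_i = -a₁` (summable),
  `p ≥ 0`, `a_i = a_T` on the `(2,2)` indices and `a_i ≥ 0` elsewhere, then the `(2,2)` total `S`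
  is summable and `a_T · S ≤ -a₁`; with `a₁ + P a_T > 0` this gives `S < P` if `a_T > 0` and
  `P < S` if `a_T < 0` (`lt_of_sign`, `gt_of_sign`) — valid for ANY functional that acts termwise
  on the sum rule (the readers' THEOREM texts discharge termwise action of the derivative functional
  at `z = z̄ = 1/2` analytically: absolute and locally uniform convergence of the `s`-series);
* `OpeA2DObligations.opeUpper` / `.opeLower` — soundness for evaluation-continuous `φ` (the typed
  termwise class of the tree), exactly parallel to `OpeObligations.opeBound`;
* `centralCharge_upper_bound` — `P < p_T = s²/(2c)`, `0 < P` ⇒ `c < s²/(2P)` (Ward identity a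
  HYPOTHESIS, as in `centralCharge_lower_bound`);
* `cTwoSided_of_bounds` — the assembled control statement: lower and upper `ope2` statements with
  `P_lo < P_hi` give, for every `A2D′` datum whose `(2,2)` total obeys the Ward identity with some
  `c > 0`, the open interval `s²/(2 P_hi) < c < s²/(2 P_lo)` (what `cover_c.py` checks on exact
  rationals; RB-6 at `Δ_σ = 1/8`, `Λ = 11`: `0.49958 < c < 0.50893`, later rungs in `SCOPE.md` §4).

NOTHING numerical is asserted here: the certificates are external exact-arithmetic objects checked by
two independent readers. Sources: sum rule and linear-functional logic, R. Rattazzi, V. S. Rychkov,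
E. Tonni, A. Vichi, JHEP 12 (2008) 031, §3–§5 (OPE-coefficient bounds §5; lower bounds need the
operator isolated — F. Caracciolo, V. S. Rychkov, Phys. Rev. D 81 (2010) 085037, §4, is the float
precedent; only the elementary sign argument is used here); Ward identity `p_T = 2h_σ²/c`,
A. A. Belavin, A. M. Polyakov, A. B. Zamolodchikov, Nucl. Phys. B 241 (1984) 333, §3. Tree:
`CrossingData`, `IsUnitary`, `SatisfiesCrossing`, `BlockPositive`, `centralCharge_lower_bound`
(`Control2DBootstrap.lean`), `ScalarsIn`, `SpinTwoIn` (`Control2DIsland.lean`),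
`EvaluationContinuous.hasSum_mul` (`Literature/…/ConformalBootstrap3D/DualFunctional.lean`).
-/

namespace Summit.CriticalPhenomena.Ising3D.Control2D

open Set
open Literature.MathematicalPhysics.QuantumFieldTheory.ConformalBootstrap3D

/-! ### The total `(2,2)` coefficient and the two typed statements -/

namespace CrossingData

/-- The set of indices sitting exactly at the stress-tensor location `(Δ, ℓ) = (2, 2)`.
[cite: RattazziEtAl2008, §5] -/
def stressSet (D : CrossingData) : Set D.ι :=
  {i | D.Δ i = 2 ∧ D.spin i = 2}

/-- The TOTAL squared OPE coefficient carried by the `(2,2)` block `k_4(z) + k_4(z̄)`: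
`p_T = ∑_{i : (Δ,ℓ) = (2,2)} p_i` (an unconditional sum; `0` if not summable, which never happens
for data satisfying the sum rule, see `indicator_tsum_bound_of_hasSum`). The sum rule only sees this
total, so the LOWER bound is a statement about it (a single quasi-primary may carry less).
[cite: RattazziEtAl2008, §3 eq. (3.6)] -/
noncomputable def stressCoeff (D : CrossingData) : ℝ :=
  ∑' i, D.stressSet.indicator D.p i

end CrossingData

/-- **Kind-`ope2`, sense upper** (format `deriv-functional-2d/4`): in every parity-symmetric unitary
solution of the 2D `⟨σσσσ⟩` sum rule at `Δ_σ = s` with scalars in `[e₁, e₂] ∪ [G, ∞)` and spin-2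
quasi-primaries in `{2} ∪ [2 + δ, ∞)`, the total `(2,2)` coefficient obeys `p_T < P`.
[cite: RattazziEtAl2008, §5] -/
def OpeUpperA2D (s G δ e₁ e₂ P : ℝ) : Prop :=
  ∀ D : CrossingData, D.IsUnitary → D.SatisfiesCrossing s →
    D.ScalarsIn (Icc e₁ e₂ ∪ Ici G) → D.SpinTwoIn ({2} ∪ Ici (2 + δ)) → D.stressCoeff < P

/-- **Kind-`ope2`, sense lower**: under the same hypotheses the total `(2,2)` coefficient obeys
`P < p_T` (in particular such a datum HAS `(2,2)` content when `P ≥ 0`). Meaningful only with the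
stress tensor isolated (`δ > 0`); the definition itself does not need it.
[cite: RattazziEtAl2008, §5] -/
def OpeLowerA2D (s G δ e₁ e₂ P : ℝ) : Prop :=
  ∀ D : CrossingData, D.IsUnitary → D.SatisfiesCrossing s →
    D.ScalarsIn (Icc e₁ e₂ ∪ Ici G) → D.SpinTwoIn ({2} ∪ Ici (2 + δ)) → P < D.stressCoeff

/-! ### The abstract termwise step -/

/-- **The termwise sign argument behind kind `ope2`.** For a summable identity
`∑_i p_i a_i = -a₁` with `p ≥ 0`, `a_i = a_T` on a set `T` of indices and `a_i ≥ 0` off `T`: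
the `T`-total `S = ∑_{i ∈ T} p_i` is summable and `a_T · S ≤ -a₁`. (Here `a_i = φ[F_-[g_i]]`,
`a₁ = φ[F_-[𝟙]]` for a functional `φ` acting termwise on the sum rule.) Elementary real analysis
(comparison of unconditional sums). [folklore] -/
theorem indicator_tsum_bound_of_hasSum {ι : Type} (T : Set ι) {p a : ι → ℝ} {a₁ aT : ℝ}
    (hs : HasSum (fun i => p i * a i) (-a₁)) (hp : ∀ i, 0 ≤ p i) (haT : aT ≠ 0)
    (hT : ∀ i, i ∈ T → a i = aT) (hpos : ∀ i, i ∉ T → 0 ≤ a i) :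
    Summable (T.indicator p) ∧ aT * ∑' i, T.indicator p i ≤ -a₁ := by
  have hfs : Summable (fun i => p i * a i) := hs.summable
  -- the `T`-part of the summable family, and its expression through the indicator of `p`
  have hgs : Summable (T.indicator fun i => p i * a i) := hfs.indicator T
  have hg_eq : (T.indicator fun i => p i * a i) = fun i => aT * T.indicator p i := by
    funext i
    by_cases hi : i ∈ T
    · rw [Set.indicator_of_mem hi, Set.indicator_of_mem hi, hT i hi, mul_comm]
    · rw [Set.indicator_of_notMem hi, Set.indicator_of_notMem hi, mul_zero]
  have hps : Summable (T.indicator p) := by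
    have h1 : Summable (fun i => aT⁻¹ * (aT * T.indicator p i)) := (hg_eq ▸ hgs).mul_left aT⁻¹
    refine h1.congr fun i => ?_
    rw [← mul_assoc, inv_mul_cancel₀ haT, one_mul]
  refine ⟨hps, ?_⟩
  -- termwise comparison `T.indicator (p·a) ≤ p·a`, summed
  have hle : ∀ i, (T.indicator fun i => p i * a i) i ≤ p i * a i := by
    intro i
    by_cases hi : i ∈ T
    · rw [Set.indicator_of_mem hi]
    · rw [Set.indicator_of_notMem hi]; exact mul_nonneg (hp i) (hpos i hi)
  have hsum := Summable.tsum_le_tsum hle hgs hfs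
  rw [hs.tsum_eq, hg_eq, tsum_mul_left] at hsum
  exact hsum

/-- Upper conclusion of the termwise step: `a₁ + P a_T > 0` and `a_T > 0` give `S < P`.
Elementary. [folklore] -/
theorem indicator_tsum_lt_of_hasSum {ι : Type} (T : Set ι) {p a : ι → ℝ} {a₁ aT P : ℝ}
    (hs : HasSum (fun i => p i * a i) (-a₁)) (hp : ∀ i, 0 ≤ p i)
    (hT : ∀ i, i ∈ T → a i = aT) (hpos : ∀ i, i ∉ T → 0 ≤ a i)
    (hI : 0 < a₁ + P * aT) (hX : 0 < aT) : ∑' i, T.indicator p i < P := by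
  obtain ⟨-, hle⟩ := indicator_tsum_bound_of_hasSum T hs hp hX.ne' hT hpos
  have hlt : aT * ∑' i, T.indicator p i < aT * P := by linarith
  exact lt_of_mul_lt_mul_left hlt hX.le

/-- Lower conclusion of the termwise step: `a₁ + P a_T > 0` and `a_T < 0` give `P < S`.
Elementary. [folklore] -/
theorem lt_indicator_tsum_of_hasSum {ι : Type} (T : Set ι) {p a : ι → ℝ} {a₁ aT P : ℝ}
    (hs : HasSum (fun i => p i * a i) (-a₁)) (hp : ∀ i, 0 ≤ p i)
    (hT : ∀ i, i ∈ T → a i = aT) (hpos : ∀ i, i ∉ T → 0 ≤ a i)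
    (hI : 0 < a₁ + P * aT) (hX : aT < 0) : P < ∑' i, T.indicator p i := by
  obtain ⟨-, hle⟩ := indicator_tsum_bound_of_hasSum T hs hp hX.ne hT hpos
  have hb : 0 < -aT := by linarith
  have hlt : (-aT) * P < (-aT) * ∑' i, T.indicator p i := by linarith
  exact lt_of_mul_lt_mul_left hlt hb.le

/-! ### Obligations of a functional and soundness for the typed termwise class -/

/-- **The obligations of a kind-`ope2` certificate** for a functional `φ` at external dimension `s`
under `A2D′` with the `ε` box `[e₁, e₂]`, scalar gap `G`, spin-2 gap `δ`, bound `P` and threshold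
`E₀`: (I′) `φ[F_-[𝟙]] + P·φ[F_-[g_T]] > 0`, and block positivity on the scalars of the box, the scalars
in `[G, E₀)`, spin 2 in `[2 + δ, E₀)`, even spins `ℓ ≥ 4` with `ℓ ≤ Δ < E₀`, and everything at or
above `E₀` (the readers' region step). The SIGN of `φ[F_-[g_T]]` is supplied separately to
`opeUpper` / `opeLower`. [cite: RattazziEtAl2008, §5.5] -/
structure OpeA2DObligations (φ : (ℝ → ℝ → ℝ) →ₗ[ℝ] ℝ) (s G δ e₁ e₂ P E₀ : ℝ) : Prop where
  /-- (I′) `φ[F_-[𝟙]] + P φ[F_-[g_T]] > 0`. -/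
  identity_ope : 0 < φ (crossF s (-1) (fun _ _ => (1 : ℝ))) + P * φ (crossF s (-1) (globalBlock 2 2))
  /-- (E) the isolated-`ε` cells. -/
  box_nonneg : ∀ Δ : ℝ, e₁ ≤ Δ → Δ ≤ e₂ → BlockPositive φ s Δ 0
  /-- (S) scalars between the gap `G` and the threshold. -/
  scalar_nonneg : ∀ Δ : ℝ, G ≤ Δ → Δ < E₀ → BlockPositive φ s Δ 0
  /-- Spin 2 above the spin-2 gap, below the threshold. -/
  spinTwo_nonneg : ∀ Δ : ℝ, 2 + δ ≤ Δ → Δ < E₀ → BlockPositive φ s Δ 2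
  /-- Even spins `ℓ ≥ 4` below the threshold (unitarity `Δ ≥ ℓ` only). -/
  spinning_nonneg : ∀ ℓ : ℕ, Even ℓ → ℓ ≠ 0 → ℓ ≠ 2 → ∀ Δ : ℝ, (ℓ : ℝ) ≤ Δ → Δ < E₀ →
    BlockPositive φ s Δ ℓ
  /-- Everything at or above the threshold (all even spins). -/
  high_nonneg : ∀ ℓ : ℕ, Even ℓ → ∀ Δ : ℝ, (ℓ : ℝ) ≤ Δ → E₀ ≤ Δ → BlockPositive φ s Δ ℓ

namespace OpeA2DObligations

variable {φ : (ℝ → ℝ → ℝ) →ₗ[ℝ] ℝ} {s G δ e₁ e₂ P E₀ : ℝ}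

/-- Every block of an `A2D′` datum other than the `(2,2)` point is covered by a positivity clause.
Elementary case analysis. [folklore] -/
theorem blockPositive_off_T (h : OpeA2DObligations φ s G δ e₁ e₂ P E₀) {D : CrossingData}
    (hU : D.IsUnitary) (hS : D.ScalarsIn (Icc e₁ e₂ ∪ Ici G)) (hT2 : D.SpinTwoIn ({2} ∪ Ici (2 + δ)))
    (i : D.ι) (hi : i ∉ D.stressSet) : BlockPositive φ s (D.Δ i) (D.spin i) := by
  obtain ⟨hev, hΔℓ, -⟩ := hU i
  rcases le_or_gt E₀ (D.Δ i) with hge | hlt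
  · exact h.high_nonneg _ hev _ hΔℓ hge
  by_cases h0 : D.spin i = 0
  · rw [h0]
    rcases hS i h0 with ⟨h1, h2⟩ | hG
    · exact h.box_nonneg _ h1 h2
    · exact h.scalar_nonneg _ hG hlt
  by_cases h2 : D.spin i = 2
  · rw [h2]
    rcases hT2 i h2 with hpt | hgap
    · exact (hi ⟨hpt, h2⟩).elim
    · exact h.spinTwo_nonneg _ hgap hlt
  · exact h.spinning_nonneg _ hev h0 h2 _ hΔℓ hlt

/-- The termwise identity for an evaluation-continuous `φ` on a datum satisfying the sum rule, in
the shape used by the abstract step. [cite: RattazziEtAl2008, §5] -/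
theorem hasSum_apply (hφ : EvaluationContinuous φ) {D : CrossingData} (hC : D.SatisfiesCrossing s) :
    HasSum (fun i => D.p i * φ (crossF s (-1) (globalBlock (D.Δ i) (D.spin i))))
      (-(φ (crossF s (-1) (fun _ _ => (1 : ℝ))))) := by
  have hs := hφ.hasSum_mul D.p (fun i => crossF s (-1) (globalBlock (D.Δ i) (D.spin i)))
    (fun z zb => -(crossF s (-1) (fun _ _ => (1 : ℝ)) z zb)) (fun z zb hz hzb => hC z zb hz hzb)
  have hneg : φ (fun z zb => -(crossF s (-1) (fun _ _ => (1 : ℝ)) z zb))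
      = -(φ (crossF s (-1) (fun _ _ => (1 : ℝ)))) := by
    rw [← map_neg]; rfl
  rw [hneg] at hs
  exact hs

/-- **Soundness of kind `ope2`, sense upper**: the obligations plus `φ[F_-[g_T]] > 0` give
`OpeUpperA2D`. PROVED (termwise sign argument). [cite: RattazziEtAl2008, §5] -/
theorem opeUpper (hφ : EvaluationContinuous φ) (h : OpeA2DObligations φ s G δ e₁ e₂ P E₀)
    (hX : 0 < φ (crossF s (-1) (globalBlock 2 2))) : OpeUpperA2D s G δ e₁ e₂ P := by
  intro D hU hC hS hT2
  unfold CrossingData.stressCoeff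
  refine indicator_tsum_lt_of_hasSum D.stressSet (hasSum_apply hφ hC) (fun i => (hU i).2.2)
    (fun i hi => ?_) (fun i hi => h.blockPositive_off_T hU hS hT2 i hi) h.identity_ope hX
  obtain ⟨hΔ, hℓ⟩ := hi
  rw [hΔ, hℓ]

/-- **Soundness of kind `ope2`, sense lower**: the obligations plus `φ[F_-[g_T]] < 0` give
`OpeLowerA2D`. PROVED (termwise sign argument; the isolation `δ > 0` is what makes a functional
with these signs exist, it is not needed for the implication). [cite: RattazziEtAl2008, §5] -/
theorem opeLower (hφ : EvaluationContinuous φ) (h : OpeA2DObligations φ s G δ e₁ e₂ P E₀)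
    (hX : φ (crossF s (-1) (globalBlock 2 2)) < 0) : OpeLowerA2D s G δ e₁ e₂ P := by
  intro D hU hC hS hT2
  unfold CrossingData.stressCoeff
  refine lt_indicator_tsum_of_hasSum D.stressSet (hasSum_apply hφ hC) (fun i => (hU i).2.2)
    (fun i hi => ?_) (fun i hi => h.blockPositive_off_T hU hS hT2 i hi) h.identity_ope hX
  obtain ⟨hΔ, hℓ⟩ := hi
  rw [hΔ, hℓ]

end OpeA2DObligations

/-! ### From two-sided `p_T` to two-sided `c` -/

/-- **From `P < p_T` to `c < Δ_σ²/(2P)`.** If `p_T = s²/(2c)` with `c > 0` (the Ward identity, a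
HYPOTHESIS) and `0 < P < p_T`, then `c < s²/(2P)`. Elementary algebra; twin of
`centralCharge_lower_bound`. [cite: BelavinPolyakovZamolodchikov1984, §3] -/
theorem centralCharge_upper_bound {s c P pT : ℝ} (hc : 0 < c) (hP : 0 < P)
    (hWard : pT = s ^ 2 / (2 * c)) (hlt : P < pT) : c < s ^ 2 / (2 * P) := by
  rw [hWard, lt_div_iff₀ (by positivity)] at hlt
  rw [lt_div_iff₀ (by positivity)]
  linarith

/-- **The two-sided central-charge control statement.** `CTwoSided s G δ e₁ e₂ c_lo c_hi`: every
parity-symmetric unitary solution of the 2D `⟨σσσσ⟩` sum rule at `Δ_σ = s` satisfying `A2D′` with the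
`ε` box `[e₁, e₂]`, whose total `(2,2)` coefficient takes the Ward-identity value `s²/(2c)` for some
`c > 0`, has `c_lo < c < c_hi`. CONTROL-ONLY. [cite: RattazziEtAl2008, §5] -/
def CTwoSided (s G δ e₁ e₂ clo chi : ℝ) : Prop :=
  ∀ D : CrossingData, D.IsUnitary → D.SatisfiesCrossing s →
    D.ScalarsIn (Icc e₁ e₂ ∪ Ici G) → D.SpinTwoIn ({2} ∪ Ici (2 + δ)) →
      ∀ c : ℝ, 0 < c → D.stressCoeff = s ^ 2 / (2 * c) → clo < c ∧ c < chi

/-- **Assembly** (what `cover_c.py` checks on exact rationals): a lower certificate `P_lo < p_T` with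
`P_lo > 0` and an upper certificate `p_T < P_hi` give `s²/(2 P_hi) < c < s²/(2 P_lo)`. PROVED.
[cite: RattazziEtAl2008, §5] -/
theorem cTwoSided_of_bounds {s G δ e₁ e₂ Plo Phi : ℝ} (hPlo : 0 < Plo)
    (hlo : OpeLowerA2D s G δ e₁ e₂ Plo) (hhi : OpeUpperA2D s G δ e₁ e₂ Phi) :
    CTwoSided s G δ e₁ e₂ (s ^ 2 / (2 * Phi)) (s ^ 2 / (2 * Plo)) := by
  intro D hU hC hS hT2 c hc hWard
  exact ⟨centralCharge_lower_bound hc hWard (hhi D hU hC hS hT2),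
    centralCharge_upper_bound hc hPlo hWard (hlo D hU hC hS hT2)⟩

/-- **RB-6, rung Λ = 11 (numbers of `SCOPE.md` §4 `### controls-1 v14`, CONTROL-ONLY)**: IF the two
`ope2` certificates of kit job j136827 hold as typed statements (`P_lo = 153511/10⁷`,
`P_hi = 156383/10⁷` at `Δ_σ = 1/8`, `ε` box `[49/50, 20001/20000]`, `G = 2`, `δ = 1`; each reader A
AND reader B PASS — external exact-arithmetic facts, taken here as hypotheses), then
`(1/8)²/(2 P_hi) < c < (1/8)²/(2 P_lo)`, i.e. `0.49958 < c < 0.50893`. The 2D Ising value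
`c = 1/2` lies inside. [cite: RattazziEtAl2008, §5] -/
theorem cTwoSided_rb6_L11
    (hlo : OpeLowerA2D (1 / 8) 2 1 (49 / 50) (20001 / 20000) (153511 / 10 ^ 7))
    (hhi : OpeUpperA2D (1 / 8) 2 1 (49 / 50) (20001 / 20000) (156383 / 10 ^ 7)) :
    CTwoSided (1 / 8) 2 1 (49 / 50) (20001 / 20000)
      ((1 / 8 : ℝ) ^ 2 / (2 * (156383 / 10 ^ 7))) ((1 / 8 : ℝ) ^ 2 / (2 * (153511 / 10 ^ 7))) :=
  cTwoSided_of_bounds (by norm_num) hlo hhi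

/-- Sanity arithmetic for the Λ = 11 rung: the certified `c` interval contains `1/2` and has the
stated decimal edges (`78125/156383 ≈ 0.499575`, `78125/153511 ≈ 0.508921`). [folklore] -/
theorem cTwoSided_rb6_L11_contains_half :
    (1 / 8 : ℝ) ^ 2 / (2 * (156383 / 10 ^ 7)) < 1 / 2 ∧
      (1 / 2 : ℝ) < (1 / 8 : ℝ) ^ 2 / (2 * (153511 / 10 ^ 7)) := by
  constructor <;> norm_num

/-- **RB-6, rung Λ = 15 (CONTROL-ONLY)**: IF the two `ope2` certificates of kit job j136827 at Λ = 15,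
E₀ = 40 hold as typed statements (`P_lo = 38541/2500000`, `P_hi = 31259/2000000`; reader A 2.4 AND reader
B 2.3 PASS each — external facts, hypotheses here), then `0.49985… < c < 0.50677…`
(`15625/31259 < c < 78125/154164`). [cite: RattazziEtAl2008, §5] -/
theorem cTwoSided_rb6_L15
    (hlo : OpeLowerA2D (1 / 8) 2 1 (49 / 50) (20001 / 20000) (38541 / 2500000))
    (hhi : OpeUpperA2D (1 / 8) 2 1 (49 / 50) (20001 / 20000) (31259 / 2000000)) :
    CTwoSided (1 / 8) 2 1 (49 / 50) (20001 / 20000)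
      ((1 / 8 : ℝ) ^ 2 / (2 * (31259 / 2000000))) ((1 / 8 : ℝ) ^ 2 / (2 * (38541 / 2500000))) :=
  cTwoSided_of_bounds (by norm_num) hlo hhi

/-- **RB-6, rung Λ = 19 (the lane's derivative order of record; CONTROL-ONLY)**: IF the two `ope2`
certificates at Λ = 19, E₀ = 48 hold as typed statements (`P_lo = 31/2000`, kit j137649, readers
j138418/j138419; `P_hi = 78129/5000000`, kit j137089, readers j137845/j137846 — external facts,
hypotheses here), then `78125/156258 < c < 125/248`, i.e. `0.4999744 < c < 0.5040323`.
[cite: RattazziEtAl2008, §5] -/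
theorem cTwoSided_rb6_L19
    (hlo : OpeLowerA2D (1 / 8) 2 1 (49 / 50) (20001 / 20000) (31 / 2000))
    (hhi : OpeUpperA2D (1 / 8) 2 1 (49 / 50) (20001 / 20000) (78129 / 5000000)) :
    CTwoSided (1 / 8) 2 1 (49 / 50) (20001 / 20000)
      ((1 / 8 : ℝ) ^ 2 / (2 * (78129 / 5000000))) ((1 / 8 : ℝ) ^ 2 / (2 * (31 / 2000))) :=
  cTwoSided_of_bounds (by norm_num) hlo hhi

/-- Sanity arithmetic for the Λ = 19 rung: the interval is `(78125/156258, 125/248)` and contains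
`1/2`. [folklore] -/
theorem cTwoSided_rb6_L19_edges :
    (1 / 8 : ℝ) ^ 2 / (2 * (78129 / 5000000)) = 78125 / 156258 ∧
      (1 / 8 : ℝ) ^ 2 / (2 * (31 / 2000)) = 125 / 248 ∧
      (78125 / 156258 : ℝ) < 1 / 2 ∧ (1 / 2 : ℝ) < 125 / 248 := by
  refine ⟨by norm_num, by norm_num, by norm_num, by norm_num⟩

end Summit.CriticalPhenomena.Ising3D.Control2D
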